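import Literature.AlgebraicGeometry.Resolution.ColonSecantDSequence
import HarnessLib

/-!
# Kawasaki's Theorem 2.9 for colon-secant sequences: `(y_{<v}, x_Λ)M : y_v y_u = (…) : y_u`

Topic: `Literature/AlgebraicGeometry/Resolution` (the `p`-standard calculus of Kawasaki's
Macaulayfication [Kawasaki2000, §2–3], in the colon form of `SecantColonAnnihilator.lean` /
`ColonSecantDSequence.lean`).

[Kawasaki2000, Thm. 2.9]: for a `p`-standard system of parameters `x₁,…,x_d` of `M`, a subsystem
of parameters `y₁,…,y_u` of `M/𝔮ᵢM` (`𝔮ᵢ = (xᵢ,…,x_d)`) with `y_u ∈ 𝔞(M)` or `y_u ∈ 𝔞(M/𝔮ᵢM)`,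
and every `v ≤ u`, `Λ ⊆ {i,…,d}`:
`(y₁,…,y_{v-1}, x_Λ)M :_M y_v y_u = (y₁,…,y_{v-1}, x_Λ)M :_M y_u` (2.9.1); `Λ = ∅` is (2.9.2).
The printed proof uses `𝔞(·)` only through Schenzel's colon annihilation [Kawasaki2000, La. 2.5],
so it holds verbatim for **colon-secant** sequences (`IsColonSecantSequence`, = `p`-standard of
type `d-1` in reversed order, with Schenzel's `𝔯` for `𝔞`): here `𝔮ᵢ ↔ (r₁,…,r_p) = rs.take p`,
`x_Λ ↔` a sub-list `xs <+ rs.take p`, and the hypothesis becomes `y_u ∈ 𝔯(M/(rs.take p)M)`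
(which contains `𝔯(M)`, `secantColonAnnihilator_le_quotient`).

* `smul_mem_of_mem_secantColonAnnihilator` — how `c ∈ 𝔯(N)` is used: `W ++ [e]` secant for `N`
  in `𝔪` and `e • n ∈ (W)N` imply `c • n ∈ (W)N` ([Kawasaki2000, La. 2.5] in colon form).
* `IsColonSecantSequence.smul_mem_of_mul_smul_mem` — (2.9.1), by induction on the number of
  elements of `rs.take p` missing from `xs`, inserting the first missing one
  (`sublist_exists_eq_append_cons`), exactly as printed (there: the largest missing index `l`).
* `IsColonSecantSequence.smul_mem_of_mul_smul_mem_nil` — (2.9.2).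

[cite: Kawasaki2000, Thm. 2.9, La. 2.5]
-/

noncomputable section

open IsLocalRing Ideal Module

universe u v

namespace Literature.AlgebraicGeometry.Resolution

variable {S : Type u} [CommRing S]

/-! ## List helpers -/

section ListLemmas

variable {α : Type*}

/-- A proper sub-list `xs <+ l` agrees with `l` up to a first missing entry `a`:
`l = l₁ ++ a :: l₂`, `xs = l₁ ++ xs₂` with `xs₂ <+ l₂`. [folklore] -/
theorem sublist_exists_eq_append_cons {xs l : List α} (h : xs.Sublist l) (hne : xs ≠ l) :
    ∃ (l₁ : List α) (a : α) (l₂ xs₂ : List α),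
      l = l₁ ++ a :: l₂ ∧ xs = l₁ ++ xs₂ ∧ xs₂.Sublist l₂ := by
  induction h
  · exact absurd rfl hne
  · rename_i l₁' l₂ a h _
    exact ⟨[], a, l₂, l₁', rfl, rfl, h⟩
  · rename_i xs₂ l₂ a h ih
    have hne' : xs₂ ≠ l₂ := fun heq => hne (by rw [heq])
    obtain ⟨m₁, b, m₂, ys₂, hl, hxs, hsub⟩ := ih hne'
    exact ⟨a :: m₁, b, m₂, ys₂, by rw [hl]; rfl, by rw [hxs]; rfl, hsub⟩

/-- `ys.take v ++ [ys[u]]` is a sub-list of `ys` for `v ≤ u`. [folklore] -/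
theorem take_append_getElem_sublist (ys : List α) {u v : ℕ} (hu : u < ys.length) (hvu : v ≤ u) :
    (ys.take v ++ [ys[u]]).Sublist ys := by
  have h1 : [ys[u]].Sublist (ys.drop v) := by
    rw [List.singleton_sublist, List.mem_iff_getElem]
    refine ⟨u - v, by rw [List.length_drop]; omega, ?_⟩
    rw [List.getElem_drop]
    exact getElem_congr_idx (by omega)
  calc (ys.take v ++ [ys[u]]).Sublist (ys.take v ++ ys.drop v) := (List.Sublist.refl _).append h1
    _ = ys := List.take_append_drop v ys

end ListLemmas

/-! ## Using `c ∈ 𝔯(N)` -/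

section Use

variable [IsLocalRing S] {N : Type v} [AddCommGroup N] [Module S N]

/-- **Colon annihilation** ([Kawasaki2000, La. 2.5] = [Schenzel1982, Satz 2.4.2], colon form, by
definition of `𝔯`): if `c ∈ 𝔯(N)`, `W ++ [e] ⊆ 𝔪` is secant for `N` and `e • n ∈ (W)N`, then
`c • n ∈ (W)N`. [cite: Kawasaki2000, La. 2.5] -/
theorem smul_mem_of_mem_secantColonAnnihilator {c : S} (hc : c ∈ secantColonAnnihilator S N)
    {W : List S} {e : S} (hsec : IsSecantSequence N (W ++ [e]))
    (hmem : ∀ r ∈ W ++ [e], r ∈ maximalIdeal S) {n : N}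
    (hn : e • n ∈ (ofList W • ⊤ : Submodule S N)) : c • n ∈ (ofList W • ⊤ : Submodule S N) := by
  have hi : W.length < (W ++ [e]).length := by simp
  have key := hc hsec hmem hi (m := n)
  rw [List.getElem_append_right (le_refl _)] at key
  simp only [Nat.sub_self, List.getElem_cons_zero, List.take_left'] at key
  exact key hn

end Use

/-! ## Theorem 2.9 -/

section TwoNine

/-- Sub-lists generate smaller ideals. [folklore] -/
theorem ofList_le_of_sublist {xs l : List S} (h : xs.Sublist l) : ofList xs ≤ ofList l :=
  Ideal.span_mono fun _ hx => h.subset hx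

variable [IsNoetherianRing S] [IsLocalRing S] {M : Type v} [AddCommGroup M] [Module S M]
  [Module.Finite S M]

/-- **Kawasaki's Theorem 2.9, (2.9.1), for colon-secant sequences.** Let `rs` be colon-secant for
`M`, `p ∈ ℕ`, `ys ⊆ 𝔪` secant for `M/(rs.take p)M`, `v ≤ u < |ys|` with
`y_u ∈ 𝔯(M/(rs.take p)M)`, and `xs` a sub-list of `rs.take p`. Then
`(y_v y_u) a ∈ (ys.take v, xs)M` implies `y_u a ∈ (ys.take v, xs)M`, i.e.
`(y_{<v}, xs)M :_M y_v y_u = (y_{<v}, xs)M :_M y_u`. [cite: Kawasaki2000, Thm. 2.9 (2.9.1)] -/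
theorem IsColonSecantSequence.smul_mem_of_mul_smul_mem {rs : List S}
    (h : IsColonSecantSequence M rs) (p : ℕ) {ys : List S}
    (hys : IsSecantSequence (M ⧸ (ofList (rs.take p) • ⊤ : Submodule S M)) ys)
    (hymem : ∀ y ∈ ys, y ∈ maximalIdeal S) {u : ℕ} (hu : u < ys.length)
    (h𝔯 : ys[u] ∈ secantColonAnnihilator S (M ⧸ (ofList (rs.take p) • ⊤ : Submodule S M)))
    {v : ℕ} (hvu : v ≤ u) {xs : List S} (hxs : xs.Sublist (rs.take p)) {a : M}
    (ha : (ys[v] * ys[u]) • a ∈ (ofList (ys.take v ++ xs) • ⊤ : Submodule S M)) :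
    ys[u] • a ∈ (ofList (ys.take v ++ xs) • ⊤ : Submodule S M) := by
  have hv : v < ys.length := lt_of_le_of_lt hvu hu
  set L := rs.take p with hLdef
  have hL : IsColonSecantSequence M L := h.take p
  have hmemL : ∀ r ∈ L, r ∈ maximalIdeal S := hL.mem_maximalIdeal
  have hsec : IsSecantSequence M (L ++ ys) := (isSecantSequence_append_iff L ys).mpr ⟨hL.1, hys⟩
  have hmem : ∀ r ∈ L ++ ys, r ∈ maximalIdeal S := fun r hr => by
    rcases List.mem_append.mp hr with hr | hr
    exacts [hmemL r hr, hymem r hr]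
  have hYv : (ys.take v ++ [ys[v]]).Sublist ys := by
    rw [← List.take_succ_eq_append_getElem hv]; exact List.take_sublist _ _
  have hYu : (ys.take v ++ [ys[u]]).Sublist ys := take_append_getElem_sublist ys hu hvu
  -- induction on the number `k` of entries of `L` missing from `xs`
  suffices key : ∀ (k : ℕ) (xs : List S), xs.Sublist L → L.length = xs.length + k →
      ∀ a : M, (ys[v] * ys[u]) • a ∈ (ofList (ys.take v ++ xs) • ⊤ : Submodule S M) →
        ys[u] • a ∈ (ofList (ys.take v ++ xs) • ⊤ : Submodule S M) by
    have hlen := hxs.length_le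
    exact key (L.length - xs.length) xs hxs (by omega) a ha
  intro k
  induction k with
  | zero =>
    -- `xs = L`: work in `N = M/(L)M`, where `ys.take v ++ [y_v y_u]` is secant and `y_u ∈ 𝔯(N)`
    intro xs hxs hlen a ha
    obtain rfl : xs = L := hxs.eq_of_length (by omega)
    have hPeq : (ofList (ys.take v ++ L) • ⊤ : Submodule S M) = ofList (L ++ ys.take v) • ⊤ := by
      rw [ofList_append_comm]
    rw [hPeq] at ha ⊢
    have h1 : IsSecantSequence M (L ++ (ys.take v ++ [ys[v]])) :=
      hsec.sublist ((List.Sublist.refl L).append hYv) hmem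
    have h2 : IsSecantSequence M (L ++ (ys.take v ++ [ys[u]])) :=
      hsec.sublist ((List.Sublist.refl L).append hYu) hmem
    rw [← List.append_assoc] at h1 h2
    have h12 : IsSecantSequence M (L ++ ys.take v ++ [ys[v] * ys[u]]) := h1.append_mul h2
    rw [List.append_assoc] at h12
    have hN : IsSecantSequence (M ⧸ (ofList L • ⊤ : Submodule S M))
        (ys.take v ++ [ys[v] * ys[u]]) := ((isSecantSequence_append_iff L _).mp h12).2
    have hNmem : ∀ r ∈ ys.take v ++ [ys[v] * ys[u]], r ∈ maximalIdeal S := fun r hr => by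
      rcases List.mem_append.mp hr with hr | hr
      · exact hymem r (List.mem_of_mem_take hr)
      · rw [List.mem_singleton.mp hr]
        exact Ideal.mul_mem_left _ _ (hymem _ (List.getElem_mem hu))
    have := smul_mem_of_mem_secantColonAnnihilator h𝔯 hN hNmem
      (n := (ofList L • ⊤ : Submodule S M).mkQ a)
      (by rw [← map_smul, mkQ_mem_ofList_smul_top_iff]; exact ha)
    rwa [← map_smul, mkQ_mem_ofList_smul_top_iff] at this
  | succ k ih =>
    intro xs hxs hlen a ha
    have hne : xs ≠ L := fun heq => by rw [heq] at hlen; omega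
    obtain ⟨l₁, a₀, l₂, xs₂, hLeq, hxseq, hsub₂⟩ := sublist_exists_eq_append_cons hxs hne
    -- the first missing entry is `a₀ = rs[t₀]` with `l₁ = rs.take t₀`
    obtain ⟨t₀, ht₀⟩ : ∃ t₀, l₁.length = t₀ := ⟨_, rfl⟩
    have ht₀L : t₀ < L.length := by rw [hLeq, List.length_append, List.length_cons]; omega
    have ht₀p : t₀ ≤ p := by
      have := List.length_take_le p rs; rw [← hLdef] at this; omega
    have ht₀r : t₀ < rs.length := lt_of_lt_of_le ht₀L (List.take_sublist p rs).length_le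
    have hrs : rs = (l₁ ++ a₀ :: l₂) ++ rs.drop p := by
      rw [← hLeq, hLdef]; exact (List.take_append_drop p rs).symm
    have ha₀ : a₀ = rs[t₀] := by
      rw [List.getElem_of_eq hrs,
        List.getElem_append_left (by rw [List.length_append, List.length_cons]; omega),
        List.getElem_append_right (by omega)]
      simp [ht₀]
    have hl₁ : l₁ = rs.take t₀ := by
      have : L.take t₀ = l₁ := by rw [hLeq, List.take_left' ht₀]
      rw [← this, hLdef, List.take_take, Nat.min_eq_left ht₀p]
    clear hrs
    subst hl₁
    subst ha₀
    -- apply the induction hypothesis to `xs' = rs.take t₀ ++ rs[t₀] :: xs₂`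
    set xs' := rs.take t₀ ++ rs[t₀] :: xs₂ with hxs'
    have hxs'L : xs'.Sublist L := by
      rw [hLeq]; exact (List.Sublist.refl _).append (hsub₂.cons_cons _)
    have hlen' : L.length = xs'.length + k := by
      rw [hxseq, List.length_append] at hlen
      rw [hxs', List.length_append, List.length_cons]; omega
    have hPle : (ofList (ys.take v ++ xs) • ⊤ : Submodule S M) ≤ ofList (ys.take v ++ xs') • ⊤ := by
      refine Submodule.smul_mono_left (ofList_le_of_sublist ((List.Sublist.refl _).append ?_))
      rw [hxseq, hxs']; exact (List.Sublist.refl _).append (List.sublist_cons_self _ _)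
    have hIH := ih xs' hxs'L hlen' a (hPle ha)
    -- `(ys.take v, xs')M = (ys.take v, xs)M + rs[t₀] M`: write `y_u a = c + rs[t₀] b`
    have hE : ofList (ys.take v ++ xs') = ofList (ys.take v ++ xs) ⊔ Ideal.span {rs[t₀]} := by
      rw [hxseq, hxs']
      simp only [ofList_append, ofList_cons]
      ac_rfl
    rw [hE, Submodule.sup_smul, Submodule.mem_sup] at hIH
    obtain ⟨c, hc, w, hw, hcw⟩ := hIH
    rw [Submodule.ideal_span_singleton_smul] at hw
    obtain ⟨b, -, rfl⟩ := (Submodule.mem_smul_pointwise_iff_exists _ _ _).mp hw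
    -- `(y_v rs[t₀]) b ∈ (ys.take v, xs)M`
    have hb : (ys[v] * rs[t₀]) • b ∈ (ofList (ys.take v ++ xs) • ⊤ : Submodule S M) := by
      have e : (ys[v] * rs[t₀]) • b = (ys[v] * ys[u]) • a - ys[v] • c := by
        rw [mul_smul, mul_smul, ← hcw, smul_add]; abel
      rw [e]
      exact Submodule.sub_mem _ ha (Submodule.smul_mem _ _ hc)
    -- work in `N₀ = M/(rs.take t₀)M`, where `rs[t₀] ∈ 𝔯(N₀)` and `W ++ [y_v rs[t₀]]` is secant,
    -- `W = xs₂ ++ ys.take v`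
    have h𝔯₀ := h.getElem_mem ht₀r
    have hPeq : (ofList (ys.take v ++ xs) • ⊤ : Submodule S M) =
        ofList (rs.take t₀ ++ (xs₂ ++ ys.take v)) • ⊤ := by
      have e : ofList (ys.take v ++ (rs.take t₀ ++ xs₂)) =
          ofList (rs.take t₀ ++ (xs₂ ++ ys.take v)) := by
        simp only [ofList_append]; ac_rfl
      rw [hxseq, e]
    have hW1 : IsSecantSequence M (rs.take t₀ ++ (xs₂ ++ ys.take v) ++ [ys[v]]) := by
      have : (rs.take t₀ ++ (xs₂ ++ ys.take v) ++ [ys[v]]).Sublist (L ++ ys) := by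
        rw [List.append_assoc, List.append_assoc, ← List.append_assoc (rs.take t₀), ← hxseq]
        exact hxs.append hYv
      exact hsec.sublist this hmem
    have hW2 : IsSecantSequence M (rs.take t₀ ++ (xs₂ ++ ys.take v) ++ [rs[t₀]]) := by
      have hsl : (xs' ++ ys.take v).Sublist (L ++ ys) := hxs'L.append (List.take_sublist _ _)
      have hperm : (xs' ++ ys.take v).Perm (rs.take t₀ ++ (xs₂ ++ ys.take v) ++ [rs[t₀]]) := by
        rw [hxs', List.append_assoc, List.cons_append, List.append_assoc]
        exact (List.Perm.append_left _ (List.perm_append_singleton _ _).symm)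
      exact hsec.of_sublist_perm hsl hperm hmem
    have hW := hW1.append_mul hW2
    rw [List.append_assoc] at hW
    have hN₀ : IsSecantSequence (M ⧸ (ofList (rs.take t₀) • ⊤ : Submodule S M))
        (xs₂ ++ ys.take v ++ [ys[v] * rs[t₀]]) := ((isSecantSequence_append_iff _ _).mp hW).2
    have hN₀mem : ∀ r ∈ xs₂ ++ ys.take v ++ [ys[v] * rs[t₀]], r ∈ maximalIdeal S := by
      intro r hr
      rcases List.mem_append.mp hr with hr | hr
      · rcases List.mem_append.mp hr with hr | hr
        · refine hmemL r (hxs.subset ?_)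
          rw [hxseq]; exact List.mem_append_right _ hr
        · exact hymem r (List.mem_of_mem_take hr)
      · rw [List.mem_singleton.mp hr]
        exact Ideal.mul_mem_left _ _ (hmemL _ (List.getElem_mem ht₀r |> fun h' =>
          hxs'L.subset (by rw [hxs']; simp)))
    have key := smul_mem_of_mem_secantColonAnnihilator h𝔯₀ hN₀ hN₀mem
      (n := (ofList (rs.take t₀) • ⊤ : Submodule S M).mkQ b)
      (by rw [← map_smul, mkQ_mem_ofList_smul_top_iff, ← hPeq]; exact hb)
    rw [← map_smul, mkQ_mem_ofList_smul_top_iff, ← hPeq] at key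
    rw [← hcw]
    exact Submodule.add_mem _ hc key

/-- **Kawasaki's (2.9.2) for colon-secant sequences**: with `rs, p, ys, u, v` as in
`smul_mem_of_mul_smul_mem`, `(y₁,…,y_{v-1})M :_M y_v y_u = (y₁,…,y_{v-1})M :_M y_u`.
[cite: Kawasaki2000, Thm. 2.9 (2.9.2)] -/
theorem IsColonSecantSequence.smul_mem_of_mul_smul_mem_nil {rs : List S}
    (h : IsColonSecantSequence M rs) (p : ℕ) {ys : List S}
    (hys : IsSecantSequence (M ⧸ (ofList (rs.take p) • ⊤ : Submodule S M)) ys)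
    (hymem : ∀ y ∈ ys, y ∈ maximalIdeal S) {u : ℕ} (hu : u < ys.length)
    (h𝔯 : ys[u] ∈ secantColonAnnihilator S (M ⧸ (ofList (rs.take p) • ⊤ : Submodule S M)))
    {v : ℕ} (hvu : v ≤ u) {a : M}
    (ha : (ys[v] * ys[u]) • a ∈ (ofList (ys.take v) • ⊤ : Submodule S M)) :
    ys[u] • a ∈ (ofList (ys.take v) • ⊤ : Submodule S M) := by
  have := h.smul_mem_of_mul_smul_mem p hys hymem hu h𝔯 hvu (List.nil_sublist _) (a := a)
    (by rwa [List.append_nil])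
  rwa [List.append_nil] at this

end TwoNine

end Literature.AlgebraicGeometry.Resolution

end
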